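import Summits.QuantumFields.YangMills.Theorems.FradkinShenkerFlowSusceptibilityToPoincareTwoBlockFactorization

/-!
# Stub `stub_reverseMartingaleVariance` of the line `rg-variance-cascade` (crux `SusceptibilityToPoincare`)

Route `FradkinShenkerFlow` of `YangMills`, crux item `stmt-QuantumFields-9441`
(`Summit.QuantumFields.YangMills.Theses.FradkinShenkerFlow.SusceptibilityToPoincare`, FS ⇒ UP),
line `rg-variance-cascade`, stub A2 `stub_reverseMartingaleVariance` — the abstract
**reverse-martingale variance identity** behind the variance cascade down a multi-resolution
family of block fields.  Pure probability, no lattice objects: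

on a probability space `(Ω, P)`, for a finite DECREASING family of sub-σ-algebras
`m 0 ≥ m 1 ≥ … ≥ m n = ⊥` of the ambient σ-algebra and a bounded measurable `f : Ω → ℝ`,

  `∫ (f − ∫ f)² dP = ∫ (f − E[f | m 0])² dP + Σ_{k<n} ∫ (E[f | m k] − E[f | m (k+1)])² dP`.

## Proof

Everything is Pythagoras for the orthogonal projections `E[· | m]` of `L²(P)`:

* `TwoBlock.integral_sub_condExp_sq` (tree, file `…TwoBlockFactorization`):
  `∫ (g − E[g|m])² = ∫ g² − ∫ E[g|m]²` for `g ∈ L²` (pull-out property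
  `∫ E[g|m] · w = ∫ g · w` for `m`-measurable `w ∈ L²`, applied to `w = E[g|m]`);
* `ReverseMartingale.integral_condExp_sub_condExp_sq`: for `m' ≤ m`,
  `∫ (E[f|m] − E[f|m'])² = ∫ E[f|m]² − ∫ E[f|m']²` (the previous item for `g = E[f|m]` and the
  tower property `E[E[f|m] | m'] = E[f|m']`, `condExp_condExp_of_le`).

Hence the sum over `k < n` TELESCOPES (as a sum of real numbers, `Finset.sum_range_sub'`) to
`∫ E[f|m 0]² − ∫ E[f|m n]²`, the first term contributes `∫ f² − ∫ E[f|m 0]²`, and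
`E[f | m n] = E[f | ⊥] = ∫ f` (`condExp_bot`) gives `∫ E[f|m n]² = (∫ f)²`; the left-hand side is
`∫ f² − (∫ f)²` by the first item with `m = ⊥`.  Only `m (k+1) ≤ m k` for `k < n`, `m j ≤ mΩ`
for `j ≤ n` and `m n = ⊥` are used.  Boundedness of `f` enters only through `f ∈ L²(P)`.

Mathlib and the tree's abstract `L²` lemmas of `…TwoBlockFactorization` only; no named facts.
-/

noncomputable section

open MeasureTheory ProbabilityTheory

namespace Summit.QuantumFields.YangMills.Theorems.SusceptibilityToPoincare.RgVarianceCascade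

namespace ReverseMartingale

variable {Ω : Type*} {m m' m0 : MeasurableSpace Ω} {μ : Measure Ω} [IsFiniteMeasure μ]

/-- A pointwise-bounded measurable real function on a finite measure space is in `L²`. [folklore] -/
theorem memLp_two_of_bound {f : Ω → ℝ} (hf : Measurable[m0] f) {M : ℝ}
    (hM : ∀ ω, |f ω| ≤ M) : MemLp f 2 μ :=
  MemLp.of_bound hf.aestronglyMeasurable M
    (Filter.Eventually.of_forall fun ω => by rw [Real.norm_eq_abs]; exact hM ω)

/-- **Pythagoras along the tower**: for nested sub-σ-algebras `m' ≤ m ≤ m0` and `f ∈ L²(μ)`,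
`∫ (μ[f|m] − μ[f|m'])² dμ = ∫ (μ[f|m])² dμ − ∫ (μ[f|m'])² dμ`, because
`μ[f|m'] = μ[μ[f|m] | m']` a.e. (tower property). [folklore] -/
theorem integral_condExp_sub_condExp_sq (hm : m ≤ m0) (hm' : m' ≤ m) {f : Ω → ℝ}
    (hf : MemLp f 2 μ) :
    ∫ ω, (μ[f|m] ω - μ[f|m'] ω) ^ 2 ∂μ = ∫ ω, (μ[f|m] ω) ^ 2 ∂μ - ∫ ω, (μ[f|m'] ω) ^ 2 ∂μ := by
  have hc : MemLp (μ[f|m]) 2 μ := hf.condExp one_le_two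
  have htower : μ[μ[f|m]|m'] =ᵐ[μ] μ[f|m'] := condExp_condExp_of_le hm' hm
  have e1 : ∫ ω, (μ[f|m] ω - μ[f|m'] ω) ^ 2 ∂μ = ∫ ω, (μ[f|m] ω - μ[μ[f|m]|m'] ω) ^ 2 ∂μ :=
    integral_congr_ae (by filter_upwards [htower] with ω hω; rw [hω])
  have e2 : ∫ ω, (μ[f|m'] ω) ^ 2 ∂μ = ∫ ω, (μ[μ[f|m]|m'] ω) ^ 2 ∂μ :=
    integral_congr_ae (by filter_upwards [htower] with ω hω; rw [hω])
  rw [e1, e2]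
  exact TwoBlock.integral_sub_condExp_sq (hm'.trans hm) hc

end ReverseMartingale

/-- `stub_reverseMartingaleVariance` — **A2, the reverse-martingale variance identity**.  On a
probability space `(Ω, P)` with a finite DECREASING family of sub-σ-algebras
`m 0 ≥ m 1 ≥ … ≥ m n = ⊥` (all `≤` the ambient one), every bounded measurable `f` satisfies
`∫ (f − ∫ f)² dP = ∫ (f − E[f | m 0])² dP + Σ_{k<n} ∫ (E[f | m k] − E[f | m (k+1)])² dP`.
Proof: each summand is `∫ E[f|m k]² − ∫ E[f|m (k+1)]²` (Pythagoras along the tower,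
`ReverseMartingale.integral_condExp_sub_condExp_sq`), the sum telescopes, the first term is
`∫ f² − ∫ E[f|m 0]²`, and `E[f | m n] = E[f | ⊥] = ∫ f` (`condExp_bot`); the left-hand side is
`∫ f² − (∫ f)²` by Pythagoras with `m = ⊥`.  (`n = 0`: the sum is empty and `m 0 = ⊥`.) [folklore] -/
theorem stub_reverseMartingaleVariance :
    ∀ (Ω : Type) [mΩ : MeasurableSpace Ω] (P : Measure Ω) [IsProbabilityMeasure P] (n : ℕ)
      (m : ℕ → MeasurableSpace Ω), (∀ j, m j ≤ mΩ) → (∀ j, m (j + 1) ≤ m j) → m n = ⊥ →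
      ∀ (f : Ω → ℝ), Measurable f → (∃ M : ℝ, ∀ ω, |f ω| ≤ M) →
      ∫ ω, (f ω - ∫ ω', f ω' ∂P) ^ 2 ∂P =
        (∫ ω, (f ω - condExp (m 0) P f ω) ^ 2 ∂P) +
        ∑ k : Fin n, ∫ ω, (condExp (m k) P f ω - condExp (m ((k : ℕ) + 1)) P f ω) ^ 2 ∂P := by
  intro Ω mΩ P _ n m hm hanti hbot f hf hbdd
  obtain ⟨M, hM⟩ := hbdd
  have hf2 : MemLp f 2 P := ReverseMartingale.memLp_two_of_bound hf hM
  -- the sum telescopes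
  have hsum : ∑ k : Fin n, ∫ ω, (P[f|m k] ω - P[f|m ((k : ℕ) + 1)] ω) ^ 2 ∂P =
      ∫ ω, (P[f|m 0] ω) ^ 2 ∂P - ∫ ω, (P[f|m n] ω) ^ 2 ∂P := by
    rw [Finset.sum_congr rfl fun (k : Fin n) _ =>
      ReverseMartingale.integral_condExp_sub_condExp_sq (hm k) (hanti k) hf2]
    exact (Fin.sum_univ_eq_sum_range
      (fun j => ∫ ω, (P[f|m j] ω) ^ 2 ∂P - ∫ ω, (P[f|m (j + 1)] ω) ^ 2 ∂P) n).trans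
      (Finset.sum_range_sub' _ n)
  -- the first term
  have h0 : ∫ ω, (f ω - P[f|m 0] ω) ^ 2 ∂P = ∫ ω, f ω ^ 2 ∂P - ∫ ω, (P[f|m 0] ω) ^ 2 ∂P :=
    TwoBlock.integral_sub_condExp_sq (hm 0) hf2
  -- the terminal level `m n = ⊥`
  have hn : ∫ ω, (P[f|m n] ω) ^ 2 ∂P = (∫ ω, f ω ∂P) ^ 2 := by
    rw [hbot, condExp_bot]
    simp
  -- the left-hand side, Pythagoras with `m = ⊥`
  have hL : ∫ ω, (f ω - ∫ ω', f ω' ∂P) ^ 2 ∂P = ∫ ω, f ω ^ 2 ∂P - (∫ ω, f ω ∂P) ^ 2 := by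
    have h := TwoBlock.integral_sub_condExp_sq (m := ⊥) (μ := P) bot_le hf2
    rw [condExp_bot] at h
    simpa using h
  rw [hsum, h0, hn, hL]
  ring

end Summit.QuantumFields.YangMills.Theorems.SusceptibilityToPoincare.RgVarianceCascade

end
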